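import Mathlib.Analysis.InnerProductSpace.Trace
import Mathlib.Analysis.Real.Sqrt
import HarnessLib

/-!
# Bär–Hanke, Lemma 24: metric traces with respect to two nearby scalar products

Topic `Literature/Geometry/Riemannian` (namespace `Literature.Geometry.Riemannian`, grouped under
`BaerHanke`). First brick of the printed proof of the named fact
`Literature.Geometry.Riemannian.BaerHankePscGluing` (`BaerHankeGluing.lean`; Bär–Hanke, *Boundary
conditions for scalar curvature*, §4.4, Thm. 42 = Thm. 4.11 of the published chapter), whose proof
runs Thm. 42 ← Thm. 27 (master deformation theorem) ← Prop. 26 ← **Lemma 24** + Lemma 25. This file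
PROVES Lemma 24 (arXiv:2012.09127, p. 11), the pointwise linear-algebra estimate controlling
`tr_{g₁} h - tr_{g₀} h` for two Euclidean scalar products `g₀`, `g₁` on a finite-dimensional real
vector space `V` with `‖g₁ - g₀‖_{g₀} ≤ 1/2`:

  `|tr_{g₁}(h) - tr_{g₀}(h)| ≤ 2 · ‖g₁ - g₀‖_{g₀} · ‖h‖_{g₀}`  for every symmetric bilinear `h`,

where `‖·‖_{g₀}` is the norm on symmetric bilinear forms induced by `g₀` (sum of squares of the
coefficients in a `g₀`-orthonormal basis).

## Dictionary (how the statement is written here)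

`V` is a finite-dimensional real inner product space; its inner product IS `g₀`. A symmetric
bilinear form is written through its `g₀`-self-adjoint operator: `g₁ - g₀ = ⟪S ·, ·⟫`,
`h = ⟪T ·, ·⟫` with `S T : V →ₗ[ℝ] V` symmetric (`LinearMap.IsSymmetric`). Then
`‖g₁ - g₀‖²_{g₀} = ∑ⱼₖ S_{jk}² = tr (S ∘ S)`, `‖h‖²_{g₀} = tr (T ∘ T)`, `tr_{g₀}(h) = tr T`, and
`tr_{g₁}(h) = tr A` for the operator `A` with `g₁(A x, y) = h(x, y)`, i.e. `(1 + S) ∘ A = T`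
(this is `PseudoRiemannianMetric.trace`: index raising w.r.t. `g₁` followed by the ordinary trace).
We prove, in this language and following the printed proof (a `g₀`-orthonormal eigenbasis of `S`,
`|(1+ρ)⁻¹ - 1| ≤ (1-|ρ|)⁻¹|ρ| ≤ 2|ρ|` for `|ρ| ≤ 1/2`, Cauchy–Schwarz):

* `BaerHanke.sq_eigenvalues_le_trace_comp_self` — each eigenvalue `ρⱼ` of `S` has
  `ρⱼ² ≤ tr (S ∘ S)` (so `|ρⱼ| ≤ 1/2` under the hypothesis `tr (S ∘ S) ≤ 1/4`);
* `BaerHanke.injective_one_add`, `BaerHanke.bijective_one_add` — `1 + S` is invertible when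
  `tr (S ∘ S) ≤ 1/4` (so `g₁` is nondegenerate and `A = (1+S)⁻¹ T` exists and is unique);
* `BaerHanke.inner_one_add_self_pos` — `g₁` is positive definite (a Euclidean scalar product);
* `BaerHanke.abs_trace_sub_trace_le` — **Lemma 24**:
  `|tr A - tr T| ≤ 2 √(tr (S∘S)) √(tr (T∘T))` whenever `(1 + S) ∘ A = T` and `tr (S ∘ S) ≤ 1/4`;
* `BaerHanke.trace_comp_self_nonneg`, `BaerHanke.sq_trace_le_finrank_mul_trace_comp_self`,
  `BaerHanke.abs_trace_le_sqrt_finrank_mul` — the two other pointwise inequalities of the proof of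
  Prop. 26 (p. 12): `tr (W²) ≥ 0` for a symmetric `W`, and `|tr_{g₀} h| ≤ √(dim V) ‖h‖_{g₀}`.

Everything is proved; no definitions and no named facts are introduced.

## References

* [BarHanke2023] C. Bär, B. Hanke, *Boundary conditions for scalar curvature*, in *Perspectives in
  scalar curvature*, Vol. 2, World Sci. 2023, 325–377 = arXiv:2012.09127, §3, Lemma 24 (p. 11 of
  the arXiv version, READ) and its use in the proof of Prop. 26 (pp. 12–13).
-/

noncomputable section

open scoped InnerProductSpace
open Finset Module

namespace Literature.Geometry.Riemannian

namespace BaerHanke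

variable {V : Type*} [NormedAddCommGroup V] [InnerProductSpace ℝ V] [FiniteDimensional ℝ V]

/-- For a symmetric operator `S` on a finite-dimensional real inner product space,
`tr (S ∘ S) = ∑ⱼ ρⱼ²` over the eigenvalues `ρⱼ` of `S` (counted by an orthonormal eigenbasis):
the square of the `g₀`-norm of the symmetric bilinear form `⟪S·,·⟫` is the sum of the squares of
its eigenvalues (first display in the proof of Bär–Hanke, Lemma 24).
[cite: BarHanke2023, §3, Lemma 24 (proof)] -/
theorem trace_comp_self_eq_sum_sq_eigenvalues {S : V →ₗ[ℝ] V} (hS : S.IsSymmetric) {n : ℕ}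
    (hn : finrank ℝ V = n) :
    LinearMap.trace ℝ V (S ∘ₗ S) = ∑ i, hS.eigenvalues hn i ^ 2 := by
  rw [LinearMap.trace_eq_sum_inner (S ∘ₗ S) (hS.eigenvectorBasis hn)]
  refine Finset.sum_congr rfl fun i _ ↦ ?_
  have h1 : S (hS.eigenvectorBasis hn i) = hS.eigenvalues hn i • hS.eigenvectorBasis hn i := by
    simp
  have hnorm : ‖hS.eigenvectorBasis hn i‖ = 1 := (hS.eigenvectorBasis hn).orthonormal.1 i
  simp only [LinearMap.coe_comp, Function.comp_apply, h1, map_smul, inner_smul_right,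
    real_inner_self_eq_norm_sq, hnorm]
  ring

/-- Each eigenvalue of a symmetric operator `S` is bounded by the `g₀`-norm of `⟪S·,·⟫`:
`ρⱼ² ≤ ∑ₖ ρₖ² = tr (S ∘ S)` ("and thus `|ρⱼ| ≤ 1/2` for each `j`" in the proof of Bär–Hanke,
Lemma 24). [cite: BarHanke2023, §3, Lemma 24 (proof)] -/
theorem sq_eigenvalues_le_trace_comp_self {S : V →ₗ[ℝ] V} (hS : S.IsSymmetric) {n : ℕ}
    (hn : finrank ℝ V = n) (i : Fin n) :
    hS.eigenvalues hn i ^ 2 ≤ LinearMap.trace ℝ V (S ∘ₗ S) := by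
  rw [trace_comp_self_eq_sum_sq_eigenvalues hS hn]
  exact Finset.single_le_sum (f := fun j ↦ hS.eigenvalues hn j ^ 2) (fun j _ ↦ sq_nonneg _)
    (Finset.mem_univ i)

/-- Under the smallness hypothesis `tr (S ∘ S) ≤ 1/4` of Bär–Hanke, Lemma 24, every eigenvalue
`ρⱼ` of `S` satisfies `-1/2 ≤ ρⱼ ≤ 1/2`. [cite: BarHanke2023, §3, Lemma 24 (proof)] -/
theorem abs_eigenvalues_le_half {S : V →ₗ[ℝ] V} (hS : S.IsSymmetric) {n : ℕ}
    (hn : finrank ℝ V = n) (hsmall : LinearMap.trace ℝ V (S ∘ₗ S) ≤ 1 / 4) (i : Fin n) :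
    |hS.eigenvalues hn i| ≤ 1 / 2 := by
  have h := (sq_eigenvalues_le_trace_comp_self hS hn i).trans hsmall
  refine abs_le_of_sq_le_sq ?_ (by norm_num)
  calc hS.eigenvalues hn i ^ 2 ≤ 1 / 4 := h
    _ = (1 / 2) ^ 2 := by norm_num

/-- The norm of `S x` is controlled by the `g₀`-norm of `⟪S·,·⟫`: `‖S x‖² ≤ tr (S ∘ S) · ‖x‖²`
(expand `x` in an orthonormal eigenbasis of the symmetric operator `S`). Consequence of the
eigenvalue bound in the proof of Bär–Hanke, Lemma 24. [cite: BarHanke2023, §3, Lemma 24 (proof)] -/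
theorem norm_sq_apply_le {S : V →ₗ[ℝ] V} (hS : S.IsSymmetric) (x : V) :
    ‖S x‖ ^ 2 ≤ LinearMap.trace ℝ V (S ∘ₗ S) * ‖x‖ ^ 2 := by
  set n := finrank ℝ V
  have hn : finrank ℝ V = n := rfl
  set b := hS.eigenvectorBasis hn with hb
  set ρ := hS.eigenvalues hn with hρ
  have h1 : ∀ i, S (b i) = ρ i • b i := fun i ↦ by
    simp [hb, hρ]
  -- `⟪b i, S x⟫ = ρ i * ⟪b i, x⟫`
  have h2 : ∀ i, ⟪b i, S x⟫_ℝ = ρ i * ⟪b i, x⟫_ℝ := fun i ↦ by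
    rw [← hS (b i) x, h1 i, inner_smul_left]
    simp
  -- Parseval for `S x` and for `x`
  have hSx : ‖S x‖ ^ 2 = ∑ i, ⟪b i, S x⟫_ℝ ^ 2 := by
    rw [← real_inner_self_eq_norm_sq, ← b.sum_inner_mul_inner (S x) (S x)]
    refine Finset.sum_congr rfl fun i _ ↦ ?_
    rw [real_inner_comm (S x) (b i), sq]
  have hx : ‖x‖ ^ 2 = ∑ i, ⟪b i, x⟫_ℝ ^ 2 := by
    rw [← real_inner_self_eq_norm_sq, ← b.sum_inner_mul_inner x x]
    refine Finset.sum_congr rfl fun i _ ↦ ?_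
    rw [real_inner_comm x (b i), sq]
  rw [hSx, hx, Finset.mul_sum]
  refine Finset.sum_le_sum fun i _ ↦ ?_
  rw [h2 i, mul_pow]
  exact mul_le_mul_of_nonneg_right (sq_eigenvalues_le_trace_comp_self hS hn i) (sq_nonneg _)

/-- If `tr (S ∘ S) ≤ 1/4` then `‖S x‖ ≤ ‖x‖ / 2`. [cite: BarHanke2023, §3, Lemma 24 (proof)] -/
theorem norm_apply_le_half {S : V →ₗ[ℝ] V} (hS : S.IsSymmetric)
    (hsmall : LinearMap.trace ℝ V (S ∘ₗ S) ≤ 1 / 4) (x : V) : ‖S x‖ ≤ ‖x‖ / 2 := by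
  have h := norm_sq_apply_le hS x
  have h' : ‖S x‖ ^ 2 ≤ (‖x‖ / 2) ^ 2 := by
    calc ‖S x‖ ^ 2 ≤ LinearMap.trace ℝ V (S ∘ₗ S) * ‖x‖ ^ 2 := h
      _ ≤ 1 / 4 * ‖x‖ ^ 2 := mul_le_mul_of_nonneg_right hsmall (sq_nonneg _)
      _ = (‖x‖ / 2) ^ 2 := by ring
  have h'' := abs_le_of_sq_le_sq h' (by positivity)
  rwa [abs_of_nonneg (norm_nonneg _)] at h''

/-- **`g₁ = g₀ + ⟪S·,·⟫` is again a Euclidean scalar product** when `‖g₁ - g₀‖_{g₀} ≤ 1/2`: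
`⟪(1 + S) x, x⟫ ≥ ‖x‖²/2 > 0` for `x ≠ 0` (the standing assumption "`g₁` Euclidean" of
Bär–Hanke, Lemma 24, is automatic under its smallness hypothesis). [cite: BarHanke2023, §3, Lemma 24] -/
theorem inner_one_add_self_pos {S : V →ₗ[ℝ] V} (hS : S.IsSymmetric)
    (hsmall : LinearMap.trace ℝ V (S ∘ₗ S) ≤ 1 / 4) {x : V} (hx : x ≠ 0) :
    0 < ⟪(1 + S) x, x⟫_ℝ := by
  have hSx := norm_apply_le_half hS hsmall x
  have hcs : |⟪S x, x⟫_ℝ| ≤ ‖S x‖ * ‖x‖ := abs_real_inner_le_norm _ _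
  have hxpos : 0 < ‖x‖ := norm_pos_iff.mpr hx
  have h1 : ⟪(1 + S) x, x⟫_ℝ = ‖x‖ ^ 2 + ⟪S x, x⟫_ℝ := by
    simp [LinearMap.add_apply, inner_add_left]
  rw [h1]
  have h2 : -(‖x‖ * ‖x‖ / 2) ≤ ⟪S x, x⟫_ℝ := by
    have := (abs_le.mp hcs).1
    nlinarith [mul_le_mul_of_nonneg_right hSx hxpos.le]
  nlinarith

/-- `1 + S` is injective when `tr (S ∘ S) ≤ 1/4` (`(1 + S) x = 0` forces `‖x‖ = ‖S x‖ ≤ ‖x‖/2`).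
[cite: BarHanke2023, §3, Lemma 24] -/
theorem injective_one_add {S : V →ₗ[ℝ] V} (hS : S.IsSymmetric)
    (hsmall : LinearMap.trace ℝ V (S ∘ₗ S) ≤ 1 / 4) :
    Function.Injective ((1 + S : V →ₗ[ℝ] V) : V → V) := by
  refine (injective_iff_map_eq_zero _).mpr fun x hx ↦ ?_
  by_contra h
  have hpos := inner_one_add_self_pos hS hsmall h
  rw [hx, inner_zero_left] at hpos
  exact lt_irrefl _ hpos

/-- `1 + S` is bijective when `tr (S ∘ S) ≤ 1/4` (injective endomorphism of a finite-dimensional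
space), so that for every `T` there is a unique `A` with `(1 + S) ∘ A = T`, namely
`A = (1 + S)⁻¹ ∘ T` — the operator whose trace is `tr_{g₁}(h)`. [cite: BarHanke2023, §3, Lemma 24] -/
theorem bijective_one_add {S : V →ₗ[ℝ] V} (hS : S.IsSymmetric)
    (hsmall : LinearMap.trace ℝ V (S ∘ₗ S) ≤ 1 / 4) :
    Function.Bijective ((1 + S : V →ₗ[ℝ] V) : V → V) :=
  ⟨injective_one_add hS hsmall,
    LinearMap.surjective_of_injective (injective_one_add hS hsmall)⟩

omit [FiniteDimensional ℝ V] in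
/-- The diagonal coefficients of a symmetric operator in an orthonormal basis are dominated by its
`g₀`-norm: `∑ᵢ ⟪bᵢ, T bᵢ⟫² ≤ ∑ᵢⱼ ⟪bⱼ, T bᵢ⟫² = tr (T ∘ T)` (the step "`∑ⱼ h_{jj}² ≤ ‖h‖²_{g₀}`"
in the proof of Bär–Hanke, Lemma 24). [cite: BarHanke2023, §3, Lemma 24 (proof)] -/
theorem sum_sq_inner_apply_le_trace_comp_self {ι : Type*} [Fintype ι] {T : V →ₗ[ℝ] V}
    (hT : T.IsSymmetric) (b : OrthonormalBasis ι ℝ V) :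
    ∑ i, ⟪b i, T (b i)⟫_ℝ ^ 2 ≤ LinearMap.trace ℝ V (T ∘ₗ T) := by
  classical
  rw [LinearMap.trace_eq_sum_inner (T ∘ₗ T) b]
  refine Finset.sum_le_sum fun i _ ↦ ?_
  -- `⟪b i, T (T (b i))⟫ = ⟪T (b i), T (b i)⟫ = ∑ j ⟪T (b i), b j⟫ ⟪b j, T (b i)⟫ ≥ ⟪b i, T (b i)⟫²`
  have h1 : ⟪b i, (T ∘ₗ T) (b i)⟫_ℝ = ∑ j, ⟪b j, T (b i)⟫_ℝ ^ 2 := by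
    rw [LinearMap.coe_comp, Function.comp_apply, ← hT (b i) (T (b i)),
      ← b.sum_inner_mul_inner (T (b i)) (T (b i))]
    refine Finset.sum_congr rfl fun j _ ↦ ?_
    rw [real_inner_comm (T (b i)) (b j), sq]
  rw [h1]
  exact Finset.single_le_sum (f := fun j ↦ ⟪b j, T (b i)⟫_ℝ ^ 2) (fun j _ ↦ sq_nonneg _)
    (Finset.mem_univ i)

/-- **Bär–Hanke, Lemma 24** (arXiv:2012.09127, p. 11). Let `V` be a finite-dimensional real vector
space with Euclidean scalar products `g₀ = ⟪·,·⟫` and `g₁ = ⟪(1 + S)·, ·⟫` (`S` symmetric) such that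
`‖g₁ - g₀‖²_{g₀} = tr (S ∘ S) ≤ 1/4`. Then for every symmetric bilinear form `h = ⟪T·,·⟫`,
`|tr_{g₁}(h) - tr_{g₀}(h)| ≤ 2 ‖g₁ - g₀‖_{g₀} ‖h‖_{g₀}`, i.e. for the operator `A` with
`(1 + S) ∘ A = T` (whose trace is `tr_{g₁}(h)`):
`|tr A - tr T| ≤ 2 √(tr (S ∘ S)) √(tr (T ∘ T))`.
Proof as printed: in a `g₀`-orthonormal eigenbasis `(bⱼ)` of `S` (eigenvalues `ρⱼ`, `|ρⱼ| ≤ 1/2`)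
one has `⟪bⱼ, A bⱼ⟫ = (1 + ρⱼ)⁻¹ h_{jj}`, `|(1 + ρⱼ)⁻¹ - 1| ≤ 2|ρⱼ|`, and Cauchy–Schwarz gives
`|∑ⱼ ((1+ρⱼ)⁻¹ - 1) h_{jj}|² ≤ 4 (∑ⱼ ρⱼ²)(∑ⱼ h_{jj}²) ≤ 4 ‖g₁ - g₀‖² ‖h‖²`.
[cite: BarHanke2023, §3, Lemma 24] -/
theorem abs_trace_sub_trace_le {S T A : V →ₗ[ℝ] V} (hS : S.IsSymmetric) (hT : T.IsSymmetric)
    (hA : (1 + S) ∘ₗ A = T) (hsmall : LinearMap.trace ℝ V (S ∘ₗ S) ≤ 1 / 4) :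
    |LinearMap.trace ℝ V A - LinearMap.trace ℝ V T| ≤
      2 * Real.sqrt (LinearMap.trace ℝ V (S ∘ₗ S)) * Real.sqrt (LinearMap.trace ℝ V (T ∘ₗ T)) := by
  set n := finrank ℝ V
  have hn : finrank ℝ V = n := rfl
  set b := hS.eigenvectorBasis hn with hb
  set ρ := hS.eigenvalues hn with hρ
  have h1 : ∀ i, S (b i) = ρ i • b i := fun i ↦ by
    simp [hb, hρ]
  have hρle : ∀ i, |ρ i| ≤ 1 / 2 := abs_eigenvalues_le_half hS hn hsmall
  have hρpos : ∀ i, 0 < 1 + ρ i := fun i ↦ by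
    have := (abs_le.mp (hρle i)).1
    linarith
  -- diagonal coefficients
  set t : Fin n → ℝ := fun i ↦ ⟪b i, T (b i)⟫_ℝ with ht
  set a : Fin n → ℝ := fun i ↦ ⟪b i, A (b i)⟫_ℝ with ha
  -- `t i = (1 + ρ i) * a i`
  have hta : ∀ i, t i = (1 + ρ i) * a i := fun i ↦ by
    have hTi : T (b i) = A (b i) + S (A (b i)) := by
      rw [← hA]; simp [LinearMap.add_apply]
    simp only [ht, ha, hTi, inner_add_right]
    rw [← hS (b i) (A (b i)), h1 i, inner_smul_left]
    simp only [conj_trivial]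
    ring
  -- the traces
  have htrT : LinearMap.trace ℝ V T = ∑ i, t i := LinearMap.trace_eq_sum_inner T b
  have htrA : LinearMap.trace ℝ V A = ∑ i, a i := LinearMap.trace_eq_sum_inner A b
  -- `tr A - tr T = ∑ c i * t i` with `c i = (1 + ρ i)⁻¹ - 1`
  set c : Fin n → ℝ := fun i ↦ (1 + ρ i)⁻¹ - 1 with hc
  have hdiff : LinearMap.trace ℝ V A - LinearMap.trace ℝ V T = ∑ i, c i * t i := by
    rw [htrA, htrT, ← Finset.sum_sub_distrib]
    refine Finset.sum_congr rfl fun i _ ↦ ?_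
    rw [hta i]
    simp only [hc]
    rw [sub_mul, inv_mul_cancel_left₀ (hρpos i).ne', one_mul]
  -- `c i ^ 2 ≤ 4 * ρ i ^ 2`
  have hcle : ∀ i, c i ^ 2 ≤ 4 * ρ i ^ 2 := fun i ↦ by
    have hlo := (abs_le.mp (hρle i)).1
    have hhi := (abs_le.mp (hρle i)).2
    have hci : c i = -ρ i / (1 + ρ i) := by
      simp only [hc]
      rw [eq_div_iff (hρpos i).ne', sub_mul, inv_mul_cancel₀ (hρpos i).ne']
      ring
    have h14 : 1 / 4 ≤ (1 + ρ i) ^ 2 := by nlinarith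
    rw [hci, div_pow, div_le_iff₀ (pow_pos (hρpos i) 2)]
    calc (-ρ i) ^ 2 = 4 * ρ i ^ 2 * (1 / 4) := by ring
      _ ≤ 4 * ρ i ^ 2 * (1 + ρ i) ^ 2 := mul_le_mul_of_nonneg_left h14 (by positivity)
  -- Cauchy–Schwarz
  have hCS : (∑ i, c i * t i) ^ 2 ≤ (∑ i, c i ^ 2) * ∑ i, t i ^ 2 :=
    Finset.sum_mul_sq_le_sq_mul_sq _ _ _
  have hsumc : ∑ i, c i ^ 2 ≤ 4 * LinearMap.trace ℝ V (S ∘ₗ S) := by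
    rw [trace_comp_self_eq_sum_sq_eigenvalues hS hn, Finset.mul_sum]
    exact Finset.sum_le_sum fun i _ ↦ hcle i
  have hsumt : ∑ i, t i ^ 2 ≤ LinearMap.trace ℝ V (T ∘ₗ T) :=
    sum_sq_inner_apply_le_trace_comp_self hT b
  have hS0 : 0 ≤ LinearMap.trace ℝ V (S ∘ₗ S) := by
    rw [trace_comp_self_eq_sum_sq_eigenvalues hS hn]
    exact Finset.sum_nonneg fun i _ ↦ sq_nonneg _
  have hT0 : 0 ≤ LinearMap.trace ℝ V (T ∘ₗ T) :=
    (Finset.sum_nonneg fun i _ ↦ sq_nonneg _).trans hsumt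
  have key : (LinearMap.trace ℝ V A - LinearMap.trace ℝ V T) ^ 2 ≤
      (2 * Real.sqrt (LinearMap.trace ℝ V (S ∘ₗ S)) *
        Real.sqrt (LinearMap.trace ℝ V (T ∘ₗ T))) ^ 2 := by
    rw [hdiff, mul_pow, mul_pow, Real.sq_sqrt hS0, Real.sq_sqrt hT0]
    calc (∑ i, c i * t i) ^ 2 ≤ (∑ i, c i ^ 2) * ∑ i, t i ^ 2 := hCS
      _ ≤ (4 * LinearMap.trace ℝ V (S ∘ₗ S)) * LinearMap.trace ℝ V (T ∘ₗ T) :=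
          mul_le_mul hsumc hsumt (Finset.sum_nonneg fun i _ ↦ sq_nonneg _) (by positivity)
      _ = 2 ^ 2 * LinearMap.trace ℝ V (S ∘ₗ S) * LinearMap.trace ℝ V (T ∘ₗ T) := by ring
  exact abs_le_of_sq_le_sq key (by positivity)

/-! ### Two further pointwise inequalities from the proof of Bär–Hanke, Prop. 26 -/

/-- For a symmetric operator `W` (a Weingarten map), `tr (W ∘ W) = ∑ⱼ ρⱼ² ≥ 0` ("since `W_t` is a
symmetric endomorphism field we have `tr(W_t²) ≥ 0`", first step of the scalar curvature
estimate (scalfin) in the proof of Bär–Hanke, Prop. 26, p. 12). [cite: BarHanke2023, §3, Prop. 26 (proof)] -/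
theorem trace_comp_self_nonneg {W : V →ₗ[ℝ] V} (hW : W.IsSymmetric) :
    0 ≤ LinearMap.trace ℝ V (W ∘ₗ W) := by
  rw [trace_comp_self_eq_sum_sq_eigenvalues hW rfl]
  exact Finset.sum_nonneg fun i _ ↦ sq_nonneg _

/-- The metric trace of a symmetric bilinear form is dominated by its norm:
`(tr_{g₀} h)² ≤ dim V · ‖h‖²_{g₀}`, i.e. `|tr T| ≤ √(dim V) √(tr (T ∘ T))` for the symmetric
operator `T` of `h` (Cauchy–Schwarz on the diagonal coefficients; the estimate
"`|tr_{γ₀}(II_t)| ≤ √(n-1) ‖II_t‖_{γ₀}`", (eq:trIIt) in the proof of Bär–Hanke, Prop. 26, p. 12,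
where `n - 1 = dim ∂M`). [cite: BarHanke2023, §3, Prop. 26 (proof)] -/
theorem sq_trace_le_finrank_mul_trace_comp_self {T : V →ₗ[ℝ] V} (hT : T.IsSymmetric) :
    LinearMap.trace ℝ V T ^ 2 ≤ finrank ℝ V * LinearMap.trace ℝ V (T ∘ₗ T) := by
  set n := finrank ℝ V
  have hn : finrank ℝ V = n := rfl
  obtain ⟨b⟩ : Nonempty (OrthonormalBasis (Fin n) ℝ V) := by
    rw [← hn]
    exact ⟨stdOrthonormalBasis ℝ V⟩
  rw [LinearMap.trace_eq_sum_inner T b]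
  have hCS : (∑ i, (1 : ℝ) * ⟪b i, T (b i)⟫_ℝ) ^ 2 ≤
      (∑ i : Fin n, (1 : ℝ) ^ 2) * ∑ i, ⟪b i, T (b i)⟫_ℝ ^ 2 :=
    Finset.sum_mul_sq_le_sq_mul_sq _ _ _
  simp only [one_mul, one_pow, Finset.sum_const, Finset.card_univ, Fintype.card_fin,
    nsmul_eq_mul, mul_one] at hCS
  exact hCS.trans (mul_le_mul_of_nonneg_left (sum_sq_inner_apply_le_trace_comp_self hT b)
    (Nat.cast_nonneg _))

/-- `|tr_{g₀} h| ≤ √(dim V) ‖h‖_{g₀}`: the square-root form of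
`sq_trace_le_finrank_mul_trace_comp_self` ((eq:trIIt) in the proof of Bär–Hanke, Prop. 26).
[cite: BarHanke2023, §3, Prop. 26 (proof)] -/
theorem abs_trace_le_sqrt_finrank_mul {T : V →ₗ[ℝ] V} (hT : T.IsSymmetric) :
    |LinearMap.trace ℝ V T| ≤
      Real.sqrt (finrank ℝ V) * Real.sqrt (LinearMap.trace ℝ V (T ∘ₗ T)) := by
  rw [← Real.sqrt_mul (Nat.cast_nonneg _)]
  exact Real.abs_le_sqrt (sq_trace_le_finrank_mul_trace_comp_self hT)

end BaerHanke

end Literature.Geometry.Riemannian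

end
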